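import Summits.SmoothPoincare4.SmoothPoincare4.Theses.EntropyRung
import Literature.Geometry.Riemannian.RoundSphereProofs
import Literature.Geometry.Riemannian.AubinYamabeSphereEuclidean
import Literature.Geometry.Riemannian.ChangGurskyYangProofs
import Literature.Geometry.Lorentzian.DalembertianCompose
import Literature.Geometry.Lorentzian.SuperharmonicFactor
import Literature.Geometry.Lorentzian.MassCapacityHarmonic
import HarnessLib

/-!
# The warped conformal factor `W = θ(2/(1 + ⟪x, p⟫))` on the round `S⁴`
(stub `helper_sphereWarpedFactor`, witness helper 6 of line `green-blowup-conformal-entropy`,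
crux `EntropyRung.SubcylindricalExistence`, item stmt-SmoothPoincare4-10871)

On Mathlib's unit sphere `S⁴ ⊂ ℝ⁵` with the round metric `g_S` (`roundMetric`, scalar curvature
`R = 12`, `scalarCurvature_roundMetric`) fix a pole `p` and the Green-type function
`F(x) = 2/(1 + ⟪x, p⟫)` of the conformal Laplacian `L = R − 6Δ` at `−p` (smooth and positive off
`−p`, `12 F − 6 Δ F = 0` off `−p`, `F → +∞` at `−p`; these are the HYPOTHESES of the stub, supplied
by the neighbour `helper_sphereGreenRound`). For a smooth concave ramp `θ` (`θ(s) = s` for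
`s ≤ s₁`, `θ` constant beyond `s₂`, `0 ≤ θ' ≤ 1`, `θ' < 1` beyond `s₁`, `θ'' ≤ 0`, `θ(s₂) > 0`,
with `1 < s₁ < s₂`) the warped factor `W = θ ∘ F` (extended by `θ(s₂)` at `−p`) is

* smooth on all of `S⁴` (it is `θ ∘ F` on the open set `{−p}ᶜ` and constant `θ(s₂)` on the
  neighbourhood `{F ≥ s₂} ∪ {−p}` of `−p`);
* positive;
* `L`-superharmonic: `R W − 6 Δ W ≥ 0`, by the chain rule
  `Δ(θ ∘ F) = θ''(F) |∇F|² + θ'(F) Δ F` (`dalembertian_real_comp`) and `6 Δ F = R F`: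
  `R W − 6 Δ W = R (θ(F) − F θ'(F)) − 6 θ''(F) |∇F|² ≥ 0`, since `θ'' ≤ 0`, `|∇F|² ≥ 0`
  (`innerDual_self_nonneg`) and the one-variable concavity fact
  `θ(s) − s θ'(s) ≥ s₁ (1 − θ'(s)) ≥ 0` for `s ≥ s₁` (mean value theorem with `θ'` antitone),
  `θ(s) − s θ'(s) = s (1 − θ'(s)) ≥ 0` for `0 < s ≤ s₁`; at `−p`, `Δ W = 0` (`W` locally constant)
  and `R W = 12 θ(s₂) > 0`;
* with `R W − 6 Δ W = 0` only where `x ≠ −p` and `F x ≤ s₁` (strictness of the concavity fact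
  beyond `s₁`, from `θ' < 1` there), and `W = F` on `{F ≤ s₁}`.

The computation is first done for an arbitrary Riemannian `4`-manifold with constant positive
scalar curvature and an abstract `F` (`warpedFactor_package`), then specialised to the round
`S⁴`. Everything is proved; no definition, no named fact.

References: R. Schoen, S.-T. Yau, Comm. Math. Phys. 65 (1979), §2 Step 1 (the concave-ramp
superharmonicity trick (2.2)–(2.3)) [SchoenYauPMT1979]; J. M. Lee, T. H. Parker, *The Yamabe
problem*, Bull. AMS 17 (1987), §6 (the conformal Laplacian and its Green function on `Sⁿ`)
[LeeParker1987]; B. O'Neill, *Semi-Riemannian geometry* (1983), Ch. 3, Def. 3.50 [ONeill1983].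
-/

noncomputable section

-- the registered namespace `Summit.SmoothPoincare4.SmoothPoincare4.Theorems` repeats a component
set_option linter.dupNamespace false

open scoped Manifold ContDiff Topology ENNReal NNReal ContinuousMap RealInnerProductSpace
open Set Filter MeasureTheory
open Literature.Geometry.Lorentzian Literature.Geometry.Riemannian

namespace Summit.SmoothPoincare4.SmoothPoincare4.Theorems

namespace SphereWarpedFactor

/-! ### One-variable facts about the concave ramp `θ` -/

/-- **Tangent-line bound for the concave ramp.** If `θ` is smooth with `θ(s) = s` for `s ≤ s₁`
and `θ'' ≤ 0`, then for `s ≥ s₁`: `s₁ (1 − θ'(s)) ≤ θ(s) − s θ'(s)` (mean value theorem on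
`[s₁, s]`: `θ(s) − s₁ = θ'(c)(s − s₁) ≥ θ'(s)(s − s₁)` as `θ'` is antitone). [folklore] -/
theorem ramp_tangent_bound {s₁ : ℝ} {θ : ℝ → ℝ} (hθ : ContDiff ℝ ∞ θ)
    (h1 : ∀ s, s ≤ s₁ → θ s = s) (h6 : ∀ s, deriv (deriv θ) s ≤ 0) {s : ℝ} (hs : s₁ ≤ s) :
    s₁ * (1 - deriv θ s) ≤ θ s - s * deriv θ s := by
  rcases hs.eq_or_lt with rfl | hlt
  · rw [h1 s₁ le_rfl]
    linarith
  · have hdiff : Differentiable ℝ θ := hθ.differentiable (by simp)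
    have hdiff' : Differentiable ℝ (deriv θ) :=
      (show ContDiff ℝ ∞ (deriv θ) from hθ.iterate_deriv 1).differentiable (by simp)
    obtain ⟨c, hc, hcd⟩ :=
      exists_deriv_eq_slope θ hlt hdiff.continuous.continuousOn hdiff.differentiableOn
    have hanti : Antitone (deriv θ) := antitone_of_deriv_nonpos hdiff' h6
    have hcs : deriv θ s ≤ deriv θ c := hanti hc.2.le
    have hθs₁ : θ s₁ = s₁ := h1 s₁ le_rfl
    have hne : s - s₁ ≠ 0 := sub_ne_zero.2 hlt.ne'
    have hmvt : θ s - s₁ = deriv θ c * (s - s₁) := by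
      rw [hcd, hθs₁, div_mul_cancel₀ _ hne]
    have hprod : 0 ≤ (s - s₁) * (deriv θ c - deriv θ s) :=
      mul_nonneg (sub_nonneg.2 hlt.le) (sub_nonneg.2 hcs)
    nlinarith [hmvt, hprod]

/-- For the concave ramp (`θ(s) = s` below `s₁`, `θ' ≤ 1`, `θ'' ≤ 0`, `0 ≤ s₁`) and `s ≥ 0`:
`0 ≤ θ(s) − s θ'(s)`. [folklore] -/
theorem ramp_sub_mul_deriv_nonneg {s₁ : ℝ} {θ : ℝ → ℝ} (hθ : ContDiff ℝ ∞ θ)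
    (h1 : ∀ s, s ≤ s₁ → θ s = s) (h4 : ∀ s, deriv θ s ≤ 1) (h6 : ∀ s, deriv (deriv θ) s ≤ 0)
    (hs₁ : 0 ≤ s₁) {s : ℝ} (hs : 0 ≤ s) : 0 ≤ θ s - s * deriv θ s := by
  rcases le_or_gt s s₁ with hle | hlt
  · rw [h1 s hle]
    have h := mul_nonneg hs (sub_nonneg.2 (h4 s))
    nlinarith [h]
  · have h := ramp_tangent_bound hθ h1 h6 hlt.le
    have h' : 0 ≤ s₁ * (1 - deriv θ s) := mul_nonneg hs₁ (sub_nonneg.2 (h4 s))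
    linarith

/-- For the concave ramp with `θ' < 1` beyond `s₁ > 0`: `0 < θ(s) − s θ'(s)` for `s > s₁`.
[folklore] -/
theorem ramp_sub_mul_deriv_pos {s₁ : ℝ} {θ : ℝ → ℝ} (hθ : ContDiff ℝ ∞ θ)
    (h1 : ∀ s, s ≤ s₁ → θ s = s) (h5 : ∀ s, s₁ < s → deriv θ s < 1)
    (h6 : ∀ s, deriv (deriv θ) s ≤ 0) (hs₁ : 0 < s₁) {s : ℝ} (hs : s₁ < s) :
    0 < θ s - s * deriv θ s := by
  have h := ramp_tangent_bound hθ h1 h6 hs.le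
  have h' : 0 < s₁ * (1 - deriv θ s) := mul_pos hs₁ (sub_pos.2 (h5 s hs))
  linarith

/-- The concave ramp is positive on `(0, ∞)`: `θ(s) = s > 0` for `s ≤ s₁`, and `θ` is monotone
(`θ' ≥ 0`), so `θ(s) ≥ θ(s₁) = s₁ > 0` beyond. [folklore] -/
theorem ramp_pos {s₁ : ℝ} {θ : ℝ → ℝ} (hθ : ContDiff ℝ ∞ θ) (h1 : ∀ s, s ≤ s₁ → θ s = s)
    (h3 : ∀ s, 0 ≤ deriv θ s) (hs₁ : 0 < s₁) {s : ℝ} (hs : 0 < s) : 0 < θ s := by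
  rcases le_or_gt s s₁ with hle | hlt
  · rw [h1 s hle]
    exact hs
  · have hmono : Monotone θ := monotone_of_deriv_nonneg (hθ.differentiable (by simp)) h3
    have h := hmono hlt.le
    rw [h1 s₁ le_rfl] at h
    linarith

/-! ### The warped factor on a Riemannian `4`-manifold of constant positive scalar curvature -/

variable {M : Type*} [TopologicalSpace M] [ChartedSpace (EuclideanSpace ℝ (Fin 4)) M]
  [IsManifold (𝓡 4) ∞ M] [T1Space M]

/-- **The warped-factor package, abstract form.** Let `g` be a Riemannian metric (with
Levi-Civita connection) of constant scalar curvature `R₀ > 0` on a `4`-manifold `M`, `p₀ ∈ M`,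
`F` smooth and positive on `{p₀}ᶜ` with `R₀ F − 6 Δ F = 0` there and `F → +∞` at `p₀`, and `θ`
a smooth concave ramp as in `helper_sphereWarpedFactor`. If `W = θ ∘ F` off `p₀` and
`W p₀ = θ(s₂)`, then `W` is smooth, positive, `R₀ W − 6 Δ W ≥ 0` with equality only off `p₀`
where `F ≤ s₁`, and `W = F` on `{F ≤ s₁}`. The superharmonicity is the concave-profile
computation of Schoen–Yau 1979, §2 Step 1, (2.2)–(2.3), for the conformal Laplacian.
[cite: SchoenYauPMT1979, §2 Step 1 (2.3)] -/
theorem warpedFactor_package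
    (g : PseudoRiemannianMetric (𝓡 4) ∞ (EuclideanSpace ℝ (Fin 4))
      (TangentSpace (𝓡 4) : M → Type _)) [g.HasLeviCivita] (hg : g.IsRiemannian) {R₀ : ℝ}
    (hR₀ : 0 < R₀) (hR : ∀ x, g.scalarCurvature x = R₀) {p₀ : M} {F W : M → ℝ}
    (hF1 : ContMDiffOn (𝓡 4) 𝓘(ℝ, ℝ) ∞ F {p₀}ᶜ) (hF2 : ∀ x, x ≠ p₀ → 0 < F x)
    (hF3 : ∀ x, x ≠ p₀ → g.scalarCurvature x * F x - 6 * g.dalembertian F x = 0)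
    (hF4 : Tendsto F (𝓝[≠] p₀) atTop) {s₁ s₂ : ℝ} (hs₁ : 1 < s₁) {θ : ℝ → ℝ}
    (hθ : ContDiff ℝ ∞ θ) (hθ1 : ∀ s, s ≤ s₁ → θ s = s) (hθ2 : ∀ s, s₂ ≤ s → θ s = θ s₂)
    (hθ3 : ∀ s, 0 ≤ deriv θ s) (hθ4 : ∀ s, deriv θ s ≤ 1) (hθ5 : ∀ s, s₁ < s → deriv θ s < 1)
    (hθ6 : ∀ s, deriv (deriv θ) s ≤ 0) (hθ7 : 0 < θ s₂)
    (hW : ∀ x, x ≠ p₀ → W x = θ (F x)) (hWp : W p₀ = θ s₂) :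
    ContMDiff (𝓡 4) 𝓘(ℝ, ℝ) ∞ W ∧ (∀ x, 0 < W x) ∧
      (∀ x, 0 ≤ g.scalarCurvature x * W x - 6 * g.dalembertian W x) ∧
      (∀ x, g.scalarCurvature x * W x - 6 * g.dalembertian W x = 0 → x ≠ p₀ ∧ F x ≤ s₁) ∧
      (∀ x, x ≠ p₀ → F x ≤ s₁ → W x = F x) := by
  have hs₁0 : 0 < s₁ := by linarith
  -- `W = θ ∘ F` near every `x ≠ p₀`
  have hWloc : ∀ x, x ≠ p₀ → W =ᶠ[𝓝 x] (θ ∘ F) := fun x hx ↦ by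
    filter_upwards [isOpen_compl_singleton.mem_nhds hx] with y hy
    exact hW y hy
  -- `W` is the constant `θ s₂` near `p₀`
  have hWpole : W =ᶠ[𝓝 p₀] fun _ ↦ θ s₂ := by
    have h1 : ∀ᶠ y in 𝓝[≠] p₀, s₂ ≤ F y := hF4.eventually (eventually_ge_atTop s₂)
    rw [eventually_nhdsWithin_iff] at h1
    filter_upwards [h1] with y hy
    by_cases hyp : y = p₀
    · rw [hyp, hWp]
    · rw [hW y hyp]
      exact hθ2 _ (hy hyp)
  -- smoothness
  have hθF : ContMDiffOn (𝓡 4) 𝓘(ℝ, ℝ) ∞ (θ ∘ F) {p₀}ᶜ := hθ.contMDiff.comp_contMDiffOn hF1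
  have hsmooth : ContMDiff (𝓡 4) 𝓘(ℝ, ℝ) ∞ W := by
    intro x
    by_cases hx : x = p₀
    · subst hx
      exact contMDiffAt_const.congr_of_eventuallyEq hWpole
    · exact (hθF.contMDiffAt (isOpen_compl_singleton.mem_nhds hx)).congr_of_eventuallyEq
        (hWloc x hx)
  -- positivity
  have hpos : ∀ x, 0 < W x := by
    intro x
    by_cases hx : x = p₀
    · rw [hx, hWp]
      exact hθ7
    · rw [hW x hx]
      exact ramp_pos hθ hθ1 hθ3 hs₁0 (hF2 x hx)
  -- the conformal Laplacian of `W` off the pole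
  have hkey : ∀ x, x ≠ p₀ →
      g.scalarCurvature x * W x - 6 * g.dalembertian W x =
        R₀ * (θ (F x) - F x * deriv θ (F x)) +
          6 * (-deriv (deriv θ) (F x)) *
            g.innerDual x (mvfderiv (𝓡 4) F x).toLinearMap (mvfderiv (𝓡 4) F x).toLinearMap := by
    intro x hx
    have hFx : ContMDiffAt (𝓡 4) 𝓘(ℝ, ℝ) ∞ F x :=
      hF1.contMDiffAt (isOpen_compl_singleton.mem_nhds hx)
    have hF2x : ContMDiffAt (𝓡 4) 𝓘(ℝ, ℝ) 2 F x := hFx.of_le (by norm_cast)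
    have hθ2x : ContDiffAt ℝ 2 θ (F x) := hθ.contDiffAt.of_le (by norm_cast)
    have hΔ : g.dalembertian W x = g.dalembertian (θ ∘ F) x :=
      g.dalembertian_congr_of_eventuallyEq (hWloc x hx)
    have h3 := hF3 x hx
    rw [hR x] at h3
    rw [hΔ, g.dalembertian_real_comp hF2x hθ2x, hW x hx, hR x]
    linear_combination (deriv θ (F x)) * h3
  have hQ : ∀ x, 0 ≤ g.innerDual x (mvfderiv (𝓡 4) F x).toLinearMap
      (mvfderiv (𝓡 4) F x).toLinearMap := fun x ↦ g.innerDual_self_nonneg hg x _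
  -- at the pole
  have hpoleval : g.scalarCurvature p₀ * W p₀ - 6 * g.dalembertian W p₀ = R₀ * θ s₂ := by
    rw [g.dalembertian_eq_zero_of_eventuallyEq hWpole, hR p₀, hWp]
    ring
  refine ⟨hsmooth, hpos, ?_, ?_, ?_⟩
  · intro x
    by_cases hx : x = p₀
    · rw [hx, hpoleval]
      exact (mul_pos hR₀ hθ7).le
    · rw [hkey x hx]
      have hA : 0 ≤ R₀ * (θ (F x) - F x * deriv θ (F x)) :=
        mul_nonneg hR₀.le (ramp_sub_mul_deriv_nonneg hθ hθ1 hθ4 hθ6 hs₁0.le (hF2 x hx).le)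
      have hB : 0 ≤ 6 * (-deriv (deriv θ) (F x)) *
          g.innerDual x (mvfderiv (𝓡 4) F x).toLinearMap (mvfderiv (𝓡 4) F x).toLinearMap :=
        mul_nonneg (mul_nonneg (by norm_num) (neg_nonneg.2 (hθ6 _))) (hQ x)
      exact add_nonneg hA hB
  · intro x hx0
    by_cases hx : x = p₀
    · rw [hx, hpoleval] at hx0
      exact absurd hx0 (mul_pos hR₀ hθ7).ne'
    · refine ⟨hx, ?_⟩
      rw [hkey x hx] at hx0
      by_contra hlt
      rw [not_le] at hlt
      have hA : 0 < R₀ * (θ (F x) - F x * deriv θ (F x)) :=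
        mul_pos hR₀ (ramp_sub_mul_deriv_pos hθ hθ1 hθ5 hθ6 hs₁0 hlt)
      have hB : 0 ≤ 6 * (-deriv (deriv θ) (F x)) *
          g.innerDual x (mvfderiv (𝓡 4) F x).toLinearMap (mvfderiv (𝓡 4) F x).toLinearMap :=
        mul_nonneg (mul_nonneg (by norm_num) (neg_nonneg.2 (hθ6 _))) (hQ x)
      linarith
  · intro x hx hle
    rw [hW x hx, hθ1 _ hle]

end SphereWarpedFactor

open SphereWarpedFactor in
/-- **Witness helper 6 of line `green-blowup-conformal-entropy`: the warped conformal factor on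
the round `S⁴`.** For the Green-type function `F = 2/(1 + ⟪x, p⟫)` of `L = R − 6Δ` at `−p`
(hypotheses: smooth and positive off `−p`, `R F − 6 Δ F = 0` off `−p`, `F → +∞` at `−p`,
`|∇F|² = F²(F − 1)`) and a smooth concave ramp `θ`, the factor `W = θ ∘ F` (value `θ(s₂)` at
`−p`) is smooth, positive, `R W − 6 Δ W ≥ 0` with equality only off `−p` where `F ≤ s₁`, and
`W = F` on `{F ≤ s₁}` (`warpedFactor_package` with `R₀ = 12`, `scalarCurvature_roundMetric`).
Schoen–Yau 1979, §2 Step 1 (concave-ramp superharmonicity); Lee–Parker 1987, §6.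
[cite: SchoenYauPMT1979, §2 Step 1 (2.3)] -/
theorem helper_sphereWarpedFactor :
    ∀ [Fact (Module.finrank ℝ (EuclideanSpace ℝ (Fin 5)) = 4 + 1)] (p : Metric.sphere (0 :
      EuclideanSpace ℝ (Fin 5)) 1) [(@roundMetric (EuclideanSpace ℝ (Fin 5)) _ _ 4
      _).HasLeviCivita], (ContMDiffOn (𝓡 4) 𝓘(ℝ, ℝ) ∞ (fun x : Metric.sphere (0 : EuclideanSpace ℝ
      (Fin 5)) 1 ↦ (2 / (1 + ⟪(x : EuclideanSpace ℝ (Fin 5)), (p : EuclideanSpace ℝ (Fin 5))⟫)))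
      {-p}ᶜ ∧ (∀ x : Metric.sphere (0 : EuclideanSpace ℝ (Fin 5)) 1, x ≠ -p → 0 < (2 / (1 + ⟪(x :
      EuclideanSpace ℝ (Fin 5)), (p : EuclideanSpace ℝ (Fin 5))⟫))) ∧ (∀ x : Metric.sphere (0 :
      EuclideanSpace ℝ (Fin 5)) 1, x ≠ -p → (@roundMetric (EuclideanSpace ℝ (Fin 5)) _ _ 4
      _).scalarCurvature x * (2 / (1 + ⟪(x : EuclideanSpace ℝ (Fin 5)), (p : EuclideanSpace ℝ (Fin
      5))⟫)) - 6 * (@roundMetric (EuclideanSpace ℝ (Fin 5)) _ _ 4 _).dalembertian (fun x :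
      Metric.sphere (0 : EuclideanSpace ℝ (Fin 5)) 1 ↦ (2 / (1 + ⟪(x : EuclideanSpace ℝ (Fin 5)), (p
      : EuclideanSpace ℝ (Fin 5))⟫))) x = 0) ∧ Tendsto (fun x : Metric.sphere (0 : EuclideanSpace ℝ
      (Fin 5)) 1 ↦ (2 / (1 + ⟪(x : EuclideanSpace ℝ (Fin 5)), (p : EuclideanSpace ℝ (Fin 5))⟫)))
      (𝓝[≠] (-p)) atTop ∧ (∀ x : Metric.sphere (0 : EuclideanSpace ℝ (Fin 5)) 1, x ≠ -p →
      (@roundMetric (EuclideanSpace ℝ (Fin 5)) _ _ 4 _).gradSq (fun x : Metric.sphere (0 :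
      EuclideanSpace ℝ (Fin 5)) 1 ↦ (2 / (1 + ⟪(x : EuclideanSpace ℝ (Fin 5)), (p : EuclideanSpace ℝ
      (Fin 5))⟫))) x = (2 / (1 + ⟪(x : EuclideanSpace ℝ (Fin 5)), (p : EuclideanSpace ℝ (Fin 5))⟫))
      ^ 2 * ((2 / (1 + ⟪(x : EuclideanSpace ℝ (Fin 5)), (p : EuclideanSpace ℝ (Fin 5))⟫)) - 1))) → ∀
      (s₁ s₂ : ℝ), 1 < s₁ → s₁ < s₂ → ∀ (θ : ℝ → ℝ), ContDiff ℝ ∞ θ → (∀ s, s ≤ s₁ → θ s = s) → (∀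
      s, s₂ ≤ s → θ s = θ s₂) → (∀ s, 0 ≤ deriv θ s) → (∀ s, deriv θ s ≤ 1) → (∀ s, s₁ < s → deriv θ
      s < 1) → (∀ s, deriv (deriv θ) s ≤ 0) → 0 < θ s₂ → ContMDiff (𝓡 4) 𝓘(ℝ, ℝ) ∞ (fun x :
      Metric.sphere (0 : EuclideanSpace ℝ (Fin 5)) 1 ↦ if x = -p then θ s₂ else θ (2 / (1 + ⟪(x :
      EuclideanSpace ℝ (Fin 5)), (p : EuclideanSpace ℝ (Fin 5))⟫))) ∧ (∀ x : Metric.sphere (0 :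
      EuclideanSpace ℝ (Fin 5)) 1, 0 < (if x = -p then θ s₂ else θ (2 / (1 + ⟪(x : EuclideanSpace ℝ
      (Fin 5)), (p : EuclideanSpace ℝ (Fin 5))⟫)))) ∧ (∀ x : Metric.sphere (0 : EuclideanSpace ℝ
      (Fin 5)) 1, 0 ≤ (@roundMetric (EuclideanSpace ℝ (Fin 5)) _ _ 4 _).scalarCurvature x * (if x =
      -p then θ s₂ else θ (2 / (1 + ⟪(x : EuclideanSpace ℝ (Fin 5)), (p : EuclideanSpace ℝ (Fin
      5))⟫))) - 6 * (@roundMetric (EuclideanSpace ℝ (Fin 5)) _ _ 4 _).dalembertian (fun x :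
      Metric.sphere (0 : EuclideanSpace ℝ (Fin 5)) 1 ↦ if x = -p then θ s₂ else θ (2 / (1 + ⟪(x :
      EuclideanSpace ℝ (Fin 5)), (p : EuclideanSpace ℝ (Fin 5))⟫))) x) ∧ (∀ x : Metric.sphere (0 :
      EuclideanSpace ℝ (Fin 5)) 1, (@roundMetric (EuclideanSpace ℝ (Fin 5)) _ _ 4 _).scalarCurvature
      x * (if x = -p then θ s₂ else θ (2 / (1 + ⟪(x : EuclideanSpace ℝ (Fin 5)), (p : EuclideanSpace
      ℝ (Fin 5))⟫))) - 6 * (@roundMetric (EuclideanSpace ℝ (Fin 5)) _ _ 4 _).dalembertian (fun x :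
      Metric.sphere (0 : EuclideanSpace ℝ (Fin 5)) 1 ↦ if x = -p then θ s₂ else θ (2 / (1 + ⟪(x :
      EuclideanSpace ℝ (Fin 5)), (p : EuclideanSpace ℝ (Fin 5))⟫))) x = 0 → x ≠ -p ∧ (2 / (1 + ⟪(x :
      EuclideanSpace ℝ (Fin 5)), (p : EuclideanSpace ℝ (Fin 5))⟫)) ≤ s₁) ∧ (∀ x : Metric.sphere (0 :
      EuclideanSpace ℝ (Fin 5)) 1, x ≠ -p → (2 / (1 + ⟪(x : EuclideanSpace ℝ (Fin 5)), (p :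
      EuclideanSpace ℝ (Fin 5))⟫)) ≤ s₁ → (if x = -p then θ s₂ else θ (2 / (1 + ⟪(x : EuclideanSpace
      ℝ (Fin 5)), (p : EuclideanSpace ℝ (Fin 5))⟫))) = (2 / (1 + ⟪(x : EuclideanSpace ℝ (Fin 5)), (p
      : EuclideanSpace ℝ (Fin 5))⟫))) := by
  intro _ p _ hF s₁ s₂ hs₁ _ θ hθ hθ1 hθ2 hθ3 hθ4 hθ5 hθ6 hθ7
  obtain ⟨hF1, hF2, hF3, hF4, -⟩ := hF
  have hR : ∀ x : Metric.sphere (0 : EuclideanSpace ℝ (Fin 5)) 1,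
      (@roundMetric (EuclideanSpace ℝ (Fin 5)) _ _ 4 _).scalarCurvature x = 12 := fun x ↦ by
    rw [scalarCurvature_roundMetric]
    norm_num
  exact warpedFactor_package (@roundMetric (EuclideanSpace ℝ (Fin 5)) _ _ 4 _)
    isRiemannian_roundMetric (by norm_num : (0 : ℝ) < 12) hR hF1 hF2 hF3 hF4 hs₁ hθ hθ1 hθ2 hθ3
    hθ4 hθ5 hθ6 hθ7 (fun x hx ↦ if_neg hx) (if_pos rfl)

end Summit.SmoothPoincare4.SmoothPoincare4.Theorems

end
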